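import Summits.NavierStokesRegularity.NavierStokesRegularity.Theses.BernoulliDeceleration
import Literature.Analysis.FluidPDE.SereginSverakPressureProofs
import HarnessLib

/-!
# Route `BernoulliDeceleration` — typed decomposition of the deciding crux `DeceleratingSetHeadBound`

Glue theorem for the split of `stmt-NavierStokesRegularity-3032`
(`Summit.NavierStokesRegularity.NavierStokesRegularity.Theses.BernoulliDeceleration.DeceleratingSetHeadBound`,
"the Bernoulli head `Π̃ = ‖u‖²/2 + p̃[u]` is bounded above on the strongly decelerating set
`D = {∂ₜ‖u‖² ≤ -2ν‖curl u‖²}`") into three pieces, a RATE DICHOTOMY on the head plus a tail: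

* **C1 `HeadTypeIOnDeceleratingSet`** (crux): the head obeys the Type-I (scale-invariant) rate on
  `D`: `∃ C, ∀ t ∈ [0,T), ∀ x, (t,x) ∈ D → (T - t) · Π̃(t,x) ≤ C` — no Type-II growth of the head
  where the fluid decelerates;
* **C2 `DeceleratingTypeIHeadRegularity`** (crux): a Type-I-rate head bound on `D` excludes singular
  points on the final slice: `u` is backward bounded at every `(T, x₀)` (Seregin–Šverák 2002 at the
  critical majorant `C/(T - t)`, i.e. a one-sided Type-I Liouville statement);
* **C3 `BoundedFlowHeadCeiling`** (support): a velocity bounded on every `(δ, T) × ℝ³` has its head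
  bounded above on `[0, T) × ℝ³`.

The three hypotheses below are LITERALLY the statements of the three children (expanded, so that
the route's glue `C1 → C2 → C3 → DeceleratingSetHeadBound` is this theorem by `δ`-unfolding); the
conclusion is the route decl itself.

Proof (the seam). C1 hands the Type-I constant to C2, which gives backward boundedness at every
point of the final slice (`IsBackwardBoundedAt u T x₀`). This pointwise statement is GLOBALISED to
a bound on `(δ, T) × ℝ³` for every `δ ∈ (0, T)` exactly as in the tree's passage from the local to
the global form of Seregin–Šverák 2002 (`seregin_sverak_2002_of_pressureOneSidedBound`,
Escauriaza–Seregin–Šverák 2003 §3 (3.5) ⇒ (3.6)): the far field `‖x‖ > R` by the ε-regularity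
criterion of Lemarié-Rieusset (2016, Thm. 14.4, proved in the tree) through
`SereginSverak2002.farField_bound`, the near field `[δ, T] × B̄(0, R)` by compactness and the
pointwise statement through `SereginSverak2002.nearField_bound`. C3 then converts the velocity
bound into a head ceiling on `[0, T) × ℝ³`, which is restricted to `D`.
-/

set_option linter.dupNamespace false -- nested layout Summit.<S>.<Sub>, Sub = S (D-0017)

namespace Summit.NavierStokesRegularity.NavierStokesRegularity.Cruxes.DeceleratingSetHeadBound.Split

open Set Metric Function
open Literature.Analysis.FluidPDE
open Summit.NavierStokesRegularity.NavierStokesRegularity.Theses.BernoulliDeceleration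

/-- **Glue of the split of `DeceleratingSetHeadBound`** (stmt-NavierStokesRegularity-3032, route
`BernoulliDeceleration`): `HeadTypeIOnDeceleratingSet → DeceleratingTypeIHeadRegularity →
BoundedFlowHeadCeiling → DeceleratingSetHeadBound`, the three hypotheses being the expanded
statements of the children. The seam is the local-to-global passage on the final slice: far field
by ε-regularity (`SereginSverak2002.farField_bound`, Lemarié-Rieusset 2016 Thm. 14.4), near field
by compactness (`SereginSverak2002.nearField_bound`), then the head ceiling of C3 restricted to
the decelerating set. [cite: EscauriazaSereginSverak2003, §3 (3.5)–(3.6); LemarieRieusset2016,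
Thm. 14.4 and proof of Thm. 14.5] -/
theorem deceleratingSetHeadBound_of_subs :
    (∀ (ν T : ℝ), 0 < ν → 0 < T → ∀ (u : ℝ → EuclideanSpace ℝ (Fin 3) → EuclideanSpace ℝ (Fin 3)) (p : ℝ → EuclideanSpace ℝ (Fin 3) → ℝ), Literature.Analysis.FluidPDE.IsClassicalNSSolutionOn (Set.Ico 0 T) ν 0 u p → Literature.Analysis.FluidPDE.IsLerayHopfOn T ν 0 (u 0) u → Literature.Analysis.FluidPDE.HasRapidSpatialDecay (u 0) → ∃ C : ℝ, ∀ t ∈ Set.Ico 0 T, ∀ x, Literature.Analysis.FluidPDE.timeDerivWithin (Set.Ico 0 T) (fun s z => ‖u s z‖ ^ 2) t x ≤ -(2 * ν * ‖Literature.Analysis.FluidPDE.curl (u t) x‖ ^ 2) → (T - t) * (‖u t x‖ ^ 2 / 2 + Literature.Analysis.FluidPDE.normalisedPressure (u t) x) ≤ C) →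
    (∀ (ν T : ℝ), 0 < ν → 0 < T → ∀ (u : ℝ → EuclideanSpace ℝ (Fin 3) → EuclideanSpace ℝ (Fin 3)) (p : ℝ → EuclideanSpace ℝ (Fin 3) → ℝ), Literature.Analysis.FluidPDE.IsClassicalNSSolutionOn (Set.Ico 0 T) ν 0 u p → Literature.Analysis.FluidPDE.IsLerayHopfOn T ν 0 (u 0) u → Literature.Analysis.FluidPDE.HasRapidSpatialDecay (u 0) → (∃ C : ℝ, ∀ t ∈ Set.Ico 0 T, ∀ x, Literature.Analysis.FluidPDE.timeDerivWithin (Set.Ico 0 T) (fun s z => ‖u s z‖ ^ 2) t x ≤ -(2 * ν * ‖Literature.Analysis.FluidPDE.curl (u t) x‖ ^ 2) → (T - t) * (‖u t x‖ ^ 2 / 2 + Literature.Analysis.FluidPDE.normalisedPressure (u t) x) ≤ C) → ∀ x₀ : EuclideanSpace ℝ (Fin 3), ∃ r > 0, ∃ M : ℝ, ∀ t ∈ Set.Ioo (T - r ^ 2) T, ∀ x ∈ Metric.ball x₀ r, ‖u t x‖ ≤ M) →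
    (∀ (ν T : ℝ), 0 < ν → 0 < T → ∀ (u : ℝ → EuclideanSpace ℝ (Fin 3) → EuclideanSpace ℝ (Fin 3)) (p : ℝ → EuclideanSpace ℝ (Fin 3) → ℝ), Literature.Analysis.FluidPDE.IsClassicalNSSolutionOn (Set.Ico 0 T) ν 0 u p → Literature.Analysis.FluidPDE.IsLerayHopfOn T ν 0 (u 0) u → Literature.Analysis.FluidPDE.HasRapidSpatialDecay (u 0) → (∀ δ ∈ Set.Ioo 0 T, ∃ M : ℝ, ∀ t ∈ Set.Ioo δ T, ∀ x, ‖u t x‖ ≤ M) → ∃ K : ℝ, ∀ t ∈ Set.Ico 0 T, ∀ x, ‖u t x‖ ^ 2 / 2 + Literature.Analysis.FluidPDE.normalisedPressure (u t) x ≤ K) →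
      DeceleratingSetHeadBound := by
  intro h₁ h₂ h₃ ν T hν hT u p hsol hLH hdec
  -- C1: the Type-I rate of the head on the decelerating set
  obtain ⟨C, hC⟩ := h₁ ν T hν hT u p hsol hLH hdec
  -- C2: no singular point on the final slice `t = T`
  have htop : ∀ x₀ : EuclideanSpace ℝ (Fin 3), IsBackwardBoundedAt u T x₀ := fun x₀ =>
    h₂ ν T hν hT u p hsol hLH hdec ⟨C, hC⟩ x₀
  -- globalisation to `(δ, T) × ℝ³`: far field by ε-regularity, near field by compactness
  have hbdd : ∀ δ ∈ Set.Ioo 0 T, ∃ M : ℝ, ∀ t ∈ Set.Ioo δ T, ∀ x, ‖u t x‖ ≤ M := by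
    intro δ hδ
    obtain ⟨R, M₁, hfar⟩ := SereginSverak2002.farField_bound hν hT hsol hLH hδ.1
    obtain ⟨M₂, hnear⟩ := SereginSverak2002.nearField_bound hT
      (SereginSverak2002.continuousOn_uncurry hsol) htop hδ.1 R
    refine ⟨max M₁ M₂, fun t ht x => ?_⟩
    by_cases hx : ‖x‖ ≤ R
    · exact (hnear (t, x) ⟨⟨ht.1.le, ht.2.le⟩, mem_closedBall_zero_iff.2 hx⟩ ht.2).trans
        (le_max_right _ _)
    · exact (hfar t ht x (not_le.1 hx)).trans (le_max_left _ _)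
  -- C3: the bounded velocity has a head ceiling on `[0, T) × ℝ³`; restrict it to `D`
  obtain ⟨K, hK⟩ := h₃ ν T hν hT u p hsol hLH hdec hbdd
  exact ⟨K, fun t ht x _ => hK t ht x⟩

end Summit.NavierStokesRegularity.NavierStokesRegularity.Cruxes.DeceleratingSetHeadBound.Split
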